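import Mathlib
import Summits.Ventures.HodgeRepro2.T5WedgeRank

/-!
# T5LocalImage — an invertible differential at one point makes the image a neighbourhood

Kernel support (blind cell pub-hodge-repro2, seat p6) for route/T5-N1-hodge-p6.md §H6, the
consequence «ω_{ab} ≠ 0 forces the image f_{ab}(S_j) ⊂ A_a × A_b to be a surface (dim 2),
f_{ab} := (f_a, f_b)».

Chart model (Remark A4.2.8's coordinates). On a chart `U ⊂ ℂ²` of the component `S_j` the map
`F_{ab} = (z_a ∘ f̃_a, z_b ∘ f̃_b) : U → ℂ²` is holomorphic; the rows of its Jacobian at `s` are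
the coefficient vectors `u, v : Fin 2 → ℂ` of the two `(1,0)`-covectors `(f_a^*e_{a,σ})_s`,
`(f_b^*e_{b,σ})_s` in the coordinates `dz_1, dz_2`, and §H6 (iii) «`F_{ab}` has invertible
differential at `s`» is `wedge10 u v = det !![u; v] ≠ 0` (T5WedgeRank, p389622).  The statements
below are the inverse function theorem in the form «then `F_{ab}` maps every neighbourhood of `s`
onto a neighbourhood of `F_{ab}(s)`», so that `F_{ab}(U)` has non-empty interior in `ℂ²` —
a set of complex dimension 2, not contained in any subset with empty interior (a curve, a point).

* `map_nhds_eq_of_surjective` / `image_mem_nhds_of_surjective` / `interior_image_nonempty`: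
  the general statement for a map with a surjective strict derivative between complete spaces
  (Mathlib `HasStrictFDerivAt.map_nhds_eq_of_surj`);
* `map_nhds_eq_of_analyticAt`: the same for a holomorphic map (`AnalyticAt.hasStrictFDerivAt`);
* `surjective_mulVec_of_det_ne_zero`, `map_nhds_eq_of_det_ne_zero`, `image_mem_nhds_of_wedge10_ne_zero`:
  the two-dimensional chart form with the Jacobian written as the matrix of rows `u, v`.

All declarations: Mathlib + own T5WedgeRank, no `sorry`, axioms ⊆ {propext, Classical.choice, Quot.sound}.
-/

namespace Summit.Ventures.HodgeRepro2.T5LocalImage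

open Filter Topology Set

section General

variable {𝕜 : Type*} [NontriviallyNormedField 𝕜] {E F : Type*} [NormedAddCommGroup E]
  [NormedSpace 𝕜 E] [NormedAddCommGroup F] [NormedSpace 𝕜 F] [CompleteSpace E] [CompleteSpace F]

/-- **Inverse function theorem, surjective form.** If `f` has a surjective strict derivative `f'`
at `a`, then `f` maps the neighbourhood filter of `a` onto the neighbourhood filter of `f a`. -/
theorem map_nhds_eq_of_surjective {f : E → F} {f' : E →L[𝕜] F} {a : E}
    (hf : HasStrictFDerivAt f f' a) (hs : Function.Surjective f') :
    map f (𝓝 a) = 𝓝 (f a) :=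
  hf.map_nhds_eq_of_surj (LinearMap.range_eq_top.mpr hs)

/-- The image of a neighbourhood of `a` is a neighbourhood of `f a`. -/
theorem image_mem_nhds_of_surjective {f : E → F} {f' : E →L[𝕜] F} {a : E}
    (hf : HasStrictFDerivAt f f' a) (hs : Function.Surjective f') {U : Set E} (hU : U ∈ 𝓝 a) :
    f '' U ∈ 𝓝 (f a) := by
  rw [← map_nhds_eq_of_surjective hf hs]
  exact image_mem_map hU

/-- The image of a neighbourhood of `a` has non-empty interior («is a surface», §H6). -/
theorem interior_image_nonempty {f : E → F} {f' : E →L[𝕜] F} {a : E}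
    (hf : HasStrictFDerivAt f f' a) (hs : Function.Surjective f') {U : Set E} (hU : U ∈ 𝓝 a) :
    (interior (f '' U)).Nonempty :=
  ⟨f a, mem_interior_iff_mem_nhds.mpr (image_mem_nhds_of_surjective hf hs hU)⟩

/-- The image of a neighbourhood of `a` is not contained in any set with empty interior
(a curve or a point of the target): the form of «the image is a surface, not a curve» used by
§H6's consequences. -/
theorem not_image_subset_of_interior_eq_empty {f : E → F} {f' : E →L[𝕜] F} {a : E}
    (hf : HasStrictFDerivAt f f' a) (hs : Function.Surjective f') {U : Set E} (hU : U ∈ 𝓝 a)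
    {C : Set F} (hC : interior C = ∅) : ¬ f '' U ⊆ C := by
  intro h
  obtain ⟨y, hy⟩ := interior_image_nonempty hf hs hU
  exact (Set.eq_empty_iff_forall_notMem.mp hC) y (interior_mono h hy)

/-- **Holomorphic form.** A map analytic at `a` whose differential at `a` is surjective maps the
neighbourhood filter of `a` onto that of `f a`. -/
theorem map_nhds_eq_of_analyticAt {f : E → F} {a : E} (hf : AnalyticAt 𝕜 f a)
    (hs : Function.Surjective (fderiv 𝕜 f a)) : map f (𝓝 a) = 𝓝 (f a) :=
  map_nhds_eq_of_surjective hf.hasStrictFDerivAt hs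

/-- Holomorphic form: the image of an open set containing `a` is a neighbourhood of `f a`. -/
theorem image_mem_nhds_of_analyticAt {f : E → F} {a : E} (hf : AnalyticAt 𝕜 f a)
    (hs : Function.Surjective (fderiv 𝕜 f a)) {U : Set E} (hUo : IsOpen U) (haU : a ∈ U) :
    f '' U ∈ 𝓝 (f a) :=
  image_mem_nhds_of_surjective hf.hasStrictFDerivAt hs (hUo.mem_nhds haU)

end General

section Dim2

/-- A `2 × 2` complex matrix with non-zero determinant acts surjectively on `ℂ²`
(`Matrix.mulVec_surjective_iff_isUnit` + `Matrix.isUnit_iff_isUnit_det`). -/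
theorem surjective_mulVec_of_det_ne_zero {M : Matrix (Fin 2) (Fin 2) ℂ} (hM : M.det ≠ 0) :
    Function.Surjective M.mulVec :=
  Matrix.mulVec_surjective_iff_isUnit.mpr
    ((Matrix.isUnit_iff_isUnit_det M).mpr (isUnit_iff_ne_zero.mpr hM))

/-- The continuous linear map of `ℂ²` given by the matrix `M` (the Jacobian), as a map, is
`M.mulVec`. -/
theorem coe_toContinuousLinearMap_toLin' (M : Matrix (Fin 2) (Fin 2) ℂ) :
    ⇑(LinearMap.toContinuousLinearMap (Matrix.toLin' M)) = M.mulVec := by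
  funext z
  rw [LinearMap.coe_toContinuousLinearMap', Matrix.toLin'_apply]

/-- **Chart form of §H6 (iii) ⇒ «surface».** If `F : ℂ² → ℂ²` has at `s` the strict derivative
given by the Jacobian matrix `M` with `det M ≠ 0`, then `F` maps the neighbourhood filter of `s`
onto that of `F s`. -/
theorem map_nhds_eq_of_det_ne_zero {F : (Fin 2 → ℂ) → (Fin 2 → ℂ)} {M : Matrix (Fin 2) (Fin 2) ℂ}
    {s : Fin 2 → ℂ} (hF : HasStrictFDerivAt F (LinearMap.toContinuousLinearMap (Matrix.toLin' M)) s)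
    (hM : M.det ≠ 0) : map F (𝓝 s) = 𝓝 (F s) :=
  map_nhds_eq_of_surjective hF
    (by rw [coe_toContinuousLinearMap_toLin']; exact surjective_mulVec_of_det_ne_zero hM)

/-- **§H6 in the covector language.** Let the rows of the Jacobian of `F` at `s` be the
coefficient vectors `u, v` of the two `(1,0)`-covectors `(f_a^*e_{a,σ})_s`, `(f_b^*e_{b,σ})_s`
(`M = Matrix.of ![u, v]`). If `wedge10 u v ≠ 0` — i.e. the covectors are linearly independent,
§H6 (ii) ⟺ (iii) — then the image of every open `U ∋ s` is a neighbourhood of `F s`: «the image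
`f_{ab}(S_j)` is a surface». -/
theorem image_mem_nhds_of_wedge10_ne_zero {F : (Fin 2 → ℂ) → (Fin 2 → ℂ)} {u v : Fin 2 → ℂ}
    {s : Fin 2 → ℂ}
    (hF : HasStrictFDerivAt F
      (LinearMap.toContinuousLinearMap (Matrix.toLin' (Matrix.of ![u, v]))) s)
    (huv : T5WedgeRank.wedge10 u v ≠ 0) {U : Set (Fin 2 → ℂ)} (hUo : IsOpen U) (hsU : s ∈ U) :
    F '' U ∈ 𝓝 (F s) := by
  rw [T5WedgeRank.wedge10_eq_det] at huv
  rw [← map_nhds_eq_of_det_ne_zero hF huv]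
  exact image_mem_map (hUo.mem_nhds hsU)

/-- §H6: under the same hypotheses the image of `U` has non-empty interior in `ℂ²` and is
therefore not contained in any subset of `ℂ²` with empty interior. -/
theorem not_image_subset_of_wedge10_ne_zero {F : (Fin 2 → ℂ) → (Fin 2 → ℂ)} {u v : Fin 2 → ℂ}
    {s : Fin 2 → ℂ}
    (hF : HasStrictFDerivAt F
      (LinearMap.toContinuousLinearMap (Matrix.toLin' (Matrix.of ![u, v]))) s)
    (huv : T5WedgeRank.wedge10 u v ≠ 0) {U : Set (Fin 2 → ℂ)} (hUo : IsOpen U) (hsU : s ∈ U)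
    {C : Set (Fin 2 → ℂ)} (hC : interior C = ∅) : ¬ F '' U ⊆ C := by
  intro h
  have hy : F s ∈ interior (F '' U) :=
    mem_interior_iff_mem_nhds.mpr (image_mem_nhds_of_wedge10_ne_zero hF huv hUo hsU)
  exact (Set.eq_empty_iff_forall_notMem.mp hC) (F s) (interior_mono h hy)

end Dim2

end Summit.Ventures.HodgeRepro2.T5LocalImage
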